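import Summits.QuantumFields.YangMills.Theorems.LuscherReductionTwistedTraceScalingBOStiffTailShellRecord
import Summits.QuantumFields.YangMills.Theorems.LuscherReductionTwistedTraceScalingFPWeightCore
import Summits.QuantumFields.YangMills.Theorems.LuscherReductionTwistedTraceScalingRecordBricks
import HarnessLib

/-!
# (B-ST) step (B), the gauge-far tail INSTANCE for the record: `κ_A ≤ 2^{d/2+2}·e^{−ℓ²/2}` pointwise, hence `⟨P₀(𝟙_A f), K_β P₀(𝟙_A f)⟩ ≤ a·Λ·‖f‖²_w`, any `a > 0`
# (lane A of S-BASE, crux `TwistedTraceScaling` stmt-QuantumFields-20203, C4-CORE, the (B-ST) pen; design card `pub/ym-fleet/ym-luscher-20007-p1/Lines-BST-poincare.md` (B); HANDOFF-g21 (S6''))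

The gauge-far door `…BOStiffTailFP.l2_basedAvg_indicator_le` wants the POINTWISE ratio bound `P₀(𝟙_Aχ)(U) ≤ κ·P₀χ(U)` for every `U`, `A = {β^{-1}ℓ < ‖P_Γ relLinkVec‖}` the gauge-far
region of the record weight `χ = recordChi L s 43 M β = 𝟙_fat·e^{−gaugeCoordSq/β^{-2}}`.  It holds, for `M ≥ M₀` of (P), with `κ = 2^{d/2+2}·e^{−ℓ²/2}` (`d = flatDim L`):
* §1 `fpWeightBar_sqrt_two_mul` — `N̄(√2·s) = 2^{d/2}·N̄(s)`; ★ `indicator_far_mul_recordWeightRho_le` — `𝟙_Aχ ≤ e^{−τ²/(2δg²)}·χ_{√2δg}` pointwise (`χ_{√2δg}` = the record weight at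
  gauge width `√2δg`, same fat tube);
* §2 ★★ `basedAvg_indicator_far_le_of_sandwich` — β-pointwise: if (P) holds on the fat tube at the two widths (`N_lo ≤ gaugeAvg χ`, `gaugeAvg χ_{√2δg} ≤ N_hi'`), then for EVERY `U`
  `P₀(𝟙_Aχ)(U) ≤ (e^{−τ²/(2δg²)}·N_hi'/N_lo)·P₀χ(U)`: `P₀ = gaugeAvg` on colour-invariant weights (`…BOStiffTailFP.basedAvg_eq_gaugeAvg_of_colourInvariant`), based invariance of
  both sides (`basedAvg_invariant`) moves `U` into the fat tube when its based orbit meets it, and both sides vanish otherwise.  (cdisprove UPDATE 21's slow-edge caution: the corner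
  orbits are excluded by (P)'s large fat radius `M ≥ M₀`, (P) being stated on the WHOLE fat tube `= supp χ`.)
* §3 ★★ `eventually_basedAvg_indicator_far_le` — the record instance via `…FPWeightCore.fpWeight_core_constant` at widths `β^{-1}` and `√2β^{-1}` (`τ = β^{-1}ℓ`, `τ²/(2δg²) = ℓ²/2`):
  `∃ M₀, ∀ M ≥ M₀, ∀ᶠ β, ∀ U, P₀(𝟙_Aχ)(U) ≤ 2^{d/2+2}e^{−ℓ²/2}·P₀χ(U)`;
* §4 ★★★ `eventually_qform_basedAvg_far_record` — with `l2_basedAvg_indicator_le`, `qform_le_sup_mul_l2` (`sup K_β ≤ (e^{2β})^{|E|}`) and the tail budget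
  `…BOStiffTailCurrency.eventually_tail_budget_le`: `∃ M₀, ∀ M ≥ M₀, ∀ a > 0, ∀ᶠ β`, for every bounded measurable `f` supported in `{recordChi ≠ 0}`,
  `⟨P₀(𝟙_A f), K_β P₀(𝟙_A f)⟩ ≤ a·Λ(β)·tubeNormSq (softWeight (recordChi L s 43 M β)) f`, `Λ` the literal currency of `…BORecordInputOfST.recordAnalyticInput_of_hST` —
  the gauge-far third of the split of `hST` (with `…BOStiffColour.tubeForm_le_qform_basedIntegral`).
HONEST FRAMING: bookkeeping for a stub of a child of the CONDITIONAL route R2b1; (B-ST) OPEN; C4-CORE OPEN; not infinite volume, not a gap, not Clay.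
-/

set_option autoImplicit false

noncomputable section

open MeasureTheory Filter Topology Real
open scoped BigOperators
open Literature.MathematicalPhysics.QuantumFieldTheory
open Literature.MathematicalPhysics.QuantumLattice

namespace Summit.QuantumFields.YangMills.Theorems.FemtoTransferGap.TwoLattice.ConstTube

open Summit.QuantumFields.YangMills.Theorems.FemtoTransferGap
open Summit.QuantumFields.YangMills.Theorems.FemtoTransferGap.TwoLattice
open Summit.QuantumFields.YangMills.Theorems.FemtoTransferGap.TwoLattice.Avg
open Summit.QuantumFields.YangMills.Theorems.FemtoTransferGap.TwoLattice.Stiff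
open Summit.QuantumFields.YangMills.Theorems.FemtoTransferGap.TwoLattice.GnChart
open Summit.QuantumFields.YangMills.Theorems.FemtoTransferGap.TwoLattice.Cov

variable {L : ℕ} [NeZero L]

/-! ## §1 Two widths -/

/-- `N̄(√2·s) = 2^{d/2}·N̄(s)`, `d = flatDim L`. [folklore] -/
theorem fpWeightBar_sqrt_two_mul (s : ℝ) : fpWeightBar L (Real.sqrt 2 * s) = (2 : ℝ) ^ (flatDim L / 2 : ℝ) * fpWeightBar L s := by
  unfold fpWeightBar
  have h2 : (Real.sqrt 2 * s) ^ 2 = 2 * s ^ 2 := by rw [mul_pow, Real.sq_sqrt (by norm_num : (0 : ℝ) ≤ 2)]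
  rw [h2, show π * (2 * s ^ 2) = 2 * (π * s ^ 2) by ring, Real.mul_rpow (by norm_num : (0 : ℝ) ≤ 2) (by positivity)]
  ring

/-- ★ **Pointwise two-width bound**: on the gauge-far region `A = {τ < ‖P_Γ relLinkVec‖}` (`τ ≥ 0`, `δg β > 0`),
`𝟙_A·χ_{δg} ≤ e^{−τ²/(2δg²)}·χ_{√2·δg}` for the record weights with the same fat tube. [folklore] -/
theorem indicator_far_mul_recordWeightRho_le (δ ρ δg : ℝ → ℝ) {β τ : ℝ} (hτ : 0 ≤ τ) (hδg : 0 < δg β) (V : GaugeConfig 3 L SU2) :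
    {V : GaugeConfig 3 L SU2 | τ < ‖(gaugeModes L).starProjection (relLinkVec L V)‖}.indicator (recordWeightRho L δ ρ δg β) V ≤
      Real.exp (-(τ ^ 2 / (2 * δg β ^ 2))) * recordWeightRho L δ ρ (fun b => Real.sqrt 2 * δg b) β V := by
  have hrhs0 : 0 ≤ Real.exp (-(τ ^ 2 / (2 * δg β ^ 2))) * recordWeightRho L δ ρ (fun b => Real.sqrt 2 * δg b) β V :=
    mul_nonneg (Real.exp_pos _).le (recordWeightRho_mem_Icc L δ ρ _ β V).1
  by_cases hV : V ∈ {V : GaugeConfig 3 L SU2 | τ < ‖(gaugeModes L).starProjection (relLinkVec L V)‖}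
  · rw [Set.indicator_of_mem hV]
    have hg : τ ^ 2 ≤ gaugeCoordSq L V := by
      unfold gaugeCoordSq; exact pow_le_pow_left₀ hτ (le_of_lt hV) 2
    unfold recordWeightRho
    show (fatTubeRho L δ ρ β).indicator (fun _ => (1 : ℝ)) V * Real.exp (-(gaugeCoordSq L V / δg β ^ 2)) ≤
      Real.exp (-(τ ^ 2 / (2 * δg β ^ 2))) * ((fatTubeRho L δ ρ β).indicator (fun _ => (1 : ℝ)) V * Real.exp (-(gaugeCoordSq L V / (Real.sqrt 2 * δg β) ^ 2)))
    have hind0 : 0 ≤ (fatTubeRho L δ ρ β).indicator (fun _ => (1 : ℝ)) V := Set.indicator_nonneg (fun _ _ => zero_le_one) V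
    have h2 : (Real.sqrt 2 * δg β) ^ 2 = 2 * δg β ^ 2 := by rw [mul_pow, Real.sq_sqrt (by norm_num : (0 : ℝ) ≤ 2)]
    rw [h2, mul_left_comm, ← Real.exp_add]
    refine mul_le_mul_of_nonneg_left (Real.exp_le_exp.mpr ?_) hind0
    have hd : 0 < δg β ^ 2 := by positivity
    have e1 : gaugeCoordSq L V / δg β ^ 2 = 2 * (gaugeCoordSq L V / (2 * δg β ^ 2)) := by field_simp
    have e2 : τ ^ 2 / (2 * δg β ^ 2) ≤ gaugeCoordSq L V / (2 * δg β ^ 2) := div_le_div_of_nonneg_right hg (by positivity)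
    rw [e1]; linarith
  · rw [Set.indicator_of_notMem hV]; exact hrhs0

/-! ## §2 ★★ The pointwise ratio bound from the (P) sandwich at two widths -/

/-- ★★ **`P₀(𝟙_Aχ) ≤ κ·P₀χ` FOR EVERY `U`, from (P) at two widths on the fat tube** (β-pointwise): `χ = recordWeightRho δ ρ δg β`, `χ' =` the same at width `√2·δg`; if
`N_lo ≤ gaugeAvg χ U` (`N_lo > 0`) and `gaugeAvg χ' U ≤ N_hi'` for all `U` in the fat tube, then `P₀(𝟙_Aχ)(U) ≤ (e^{−τ²/(2δg²)}·N_hi'/N_lo)·P₀χ(U)` for all `U`.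
[cite: Luscher1983, §3] [cite: SeilerLNP1982, §2] -/
theorem basedAvg_indicator_far_le_of_sandwich (δ ρ δg : ℝ → ℝ) {β τ Nlo Nhi : ℝ} (hτ : 0 ≤ τ) (hδg : 0 < δg β) (hNlo : 0 < Nlo)
    (hlo : ∀ U ∈ fatTubeRho L δ ρ β, Nlo ≤ gaugeAvg (recordWeightRho L δ ρ δg β) U)
    (hhi : ∀ U ∈ fatTubeRho L δ ρ β, gaugeAvg (recordWeightRho L δ ρ (fun b => Real.sqrt 2 * δg b) β) U ≤ Nhi) (U : GaugeConfig 3 L SU2) :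
    ∫ h, {V : GaugeConfig 3 L SU2 | τ < ‖(gaugeModes L).starProjection (relLinkVec L V)‖}.indicator (recordWeightRho L δ ρ δg β) (gaugeTransform (basedExt L h) U)
        ∂basedMeasure L ≤
      (Real.exp (-(τ ^ 2 / (2 * δg β ^ 2))) * Nhi / Nlo) * ∫ h, recordWeightRho L δ ρ δg β (gaugeTransform (basedExt L h) U) ∂basedMeasure L := by
  haveI : IsProbabilityMeasure (basedMeasure L) := by unfold basedMeasure; infer_instance
  set A : Set (GaugeConfig 3 L SU2) := {V | τ < ‖(gaugeModes L).starProjection (relLinkVec L V)‖} with hAdef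
  set χ := recordWeightRho L δ ρ δg β with hχdef
  set χ' := recordWeightRho L δ ρ (fun b => Real.sqrt 2 * δg b) β with hχ'def
  set e : ℝ := Real.exp (-(τ ^ 2 / (2 * δg β ^ 2))) with hedef
  have he0 : 0 ≤ e := (Real.exp_pos _).le
  have hA : MeasurableSet A :=
    measurableSet_lt measurable_const ((gaugeModes L).starProjection.continuous.norm.measurable.comp (measurable_relLinkVec L))
  -- measurability / bounds of the weights
  have hχm : Measurable χ := measurable_recordWeightRho L δ ρ δg β
  have hχ'm : Measurable χ' := measurable_recordWeightRho L δ ρ _ β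
  have hχ0 : ∀ V, 0 ≤ χ V := fun V => (recordWeightRho_mem_Icc L δ ρ δg β V).1
  have hχ1 : ∀ V, |χ V| ≤ 1 := fun V => by rw [abs_of_nonneg (hχ0 V)]; exact (recordWeightRho_mem_Icc L δ ρ δg β V).2
  have hχ'0 : ∀ V, 0 ≤ χ' V := fun V => (recordWeightRho_mem_Icc L δ ρ _ β V).1
  have hχ'1 : ∀ V, |χ' V| ≤ 1 := fun V => by rw [abs_of_nonneg (hχ'0 V)]; exact (recordWeightRho_mem_Icc L δ ρ _ β V).2
  have hN0 : 0 ≤ ∫ h, χ (gaugeTransform (basedExt L h) U) ∂basedMeasure L := integral_nonneg fun h => hχ0 _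
  -- Nhi ≥ 0 when the fat tube is nonempty is not needed: we split on whether the based orbit of `U` meets the fat tube
  by_cases hmeet : ∃ h₀ : NzSite L → SU2, gaugeTransform (basedExt L h₀) U ∈ fatTubeRho L δ ρ β
  · obtain ⟨h₀, hV₀⟩ := hmeet
    set V₀ := gaugeTransform (basedExt L h₀) U with hV₀def
    -- step 1: `P₀(𝟙_Aχ)(U) ≤ e·P₀χ'(U)`
    have h1 : ∫ h, A.indicator χ (gaugeTransform (basedExt L h) U) ∂basedMeasure L ≤ e * ∫ h, χ' (gaugeTransform (basedExt L h) U) ∂basedMeasure L := by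
      rw [← integral_const_mul]
      refine integral_mono_of_nonneg (ae_of_all _ fun h => Set.indicator_nonneg (fun V _ => hχ0 V) _) ?_ (ae_of_all _ fun h => ?_)
      · exact (integrable_of_measurable_abs_le _ (measurable_comp_basedExt_left hχ'm U) (C := 1) fun h => hχ'1 _).const_mul e
      · exact indicator_far_mul_recordWeightRho_le δ ρ δg hτ hδg _
    -- step 2: `P₀χ' = gaugeAvg χ'`, `P₀χ = gaugeAvg χ`, and move to `V₀` by based invariance
    have h2 : (∫ h, χ' (gaugeTransform (basedExt L h) U) ∂basedMeasure L) = gaugeAvg χ' V₀ := by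
      rw [hV₀def, gaugeAvg_gaugeTransform]
      exact basedAvg_eq_gaugeAvg_of_colourInvariant hχ'm hχ'1 (fun c V => recordWeightRho_conj L c δ ρ _ β V) U
    have h3 : (∫ h, χ (gaugeTransform (basedExt L h) U) ∂basedMeasure L) = gaugeAvg χ V₀ := by
      rw [hV₀def, gaugeAvg_gaugeTransform]
      exact basedAvg_eq_gaugeAvg_of_colourInvariant hχm hχ1 (fun c V => recordWeightRho_conj L c δ ρ δg β V) U
    have hhi₀ : gaugeAvg χ' V₀ ≤ Nhi := hhi V₀ hV₀
    have hlo₀ : Nlo ≤ gaugeAvg χ V₀ := hlo V₀ hV₀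
    calc ∫ h, A.indicator χ (gaugeTransform (basedExt L h) U) ∂basedMeasure L ≤ e * gaugeAvg χ' V₀ := by rw [← h2]; exact h1
      _ ≤ e * Nhi := mul_le_mul_of_nonneg_left hhi₀ he0
      _ = (e * Nhi / Nlo) * Nlo := by field_simp
      _ ≤ (e * Nhi / Nlo) * gaugeAvg χ V₀ := by
          have hk : 0 ≤ e * Nhi / Nlo := by
            have : 0 ≤ Nhi := le_trans ((gaugeAvg_mem_Icc hχ'm (fun V => hχ'0 V) (fun V => (abs_le.mp (hχ'1 V)).2) V₀).1) hhi₀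
            positivity
          exact mul_le_mul_of_nonneg_left hlo₀ hk
      _ = (e * Nhi / Nlo) * ∫ h, χ (gaugeTransform (basedExt L h) U) ∂basedMeasure L := by rw [h3]
  · -- the based orbit misses the fat tube: the left side vanishes
    push Not at hmeet
    have h0 : ∫ h, A.indicator χ (gaugeTransform (basedExt L h) U) ∂basedMeasure L = 0 := by
      refine integral_eq_zero_of_ae (ae_of_all _ fun h => ?_)
      have hz : χ (gaugeTransform (basedExt L h) U) = 0 := by
        rw [hχdef]; unfold recordWeightRho; rw [Set.indicator_of_notMem (hmeet h), zero_mul]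
      show A.indicator χ (gaugeTransform (basedExt L h) U) = 0
      by_cases hmem : gaugeTransform (basedExt L h) U ∈ A
      · rw [Set.indicator_of_mem hmem, hz]
      · rw [Set.indicator_of_notMem hmem]
    rw [h0]
    by_cases hNhi : 0 ≤ Nhi
    · exact mul_nonneg (by positivity) hN0
    · -- then the fat tube is empty... but we only need the sign of the right side: if `Nhi < 0` the hypothesis `hhi` with a nonneg average forces the fat tube empty;
      -- either way `P₀χ(U) = 0` here since the orbit misses the tube, so the right side is `0`.
      have hN : ∫ h, χ (gaugeTransform (basedExt L h) U) ∂basedMeasure L = 0 := by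
        refine integral_eq_zero_of_ae (ae_of_all _ fun h => ?_)
        show χ (gaugeTransform (basedExt L h) U) = 0
        rw [hχdef]; unfold recordWeightRho; rw [Set.indicator_of_notMem (hmeet h), zero_mul]
      rw [hN, mul_zero]

/-! ## §3 ★★ The record instance, eventually in `β` -/

/-- `√2·β^{-1} ≤ (43β^{-s})³` and positivity, eventually (`0 < s ≤ 1/3`). [folklore] -/
theorem eventually_sqrt_two_width_le {s : ℝ} (hs3 : s ≤ 1 / 3) :
    ∀ᶠ β : ℝ in atTop, 0 < Real.sqrt 2 * powScale 1 β ∧ Real.sqrt 2 * powScale 1 β ≤ (43 * powScale s β) ^ 3 := by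
  filter_upwards [eventually_ge_atTop (1 : ℝ)] with β hβ
  have hp : 0 < powScale 1 β := powScale_pos 1 β
  refine ⟨by positivity, ?_⟩
  have h1 : powScale 1 β ≤ powScale s β ^ 3 := powScale_one_le_cube hs3 hβ
  have h2 : Real.sqrt 2 ≤ 2 := by
    rw [show (2 : ℝ) = Real.sqrt 4 by rw [show (4 : ℝ) = 2 ^ 2 by norm_num, Real.sqrt_sq (by norm_num : (0:ℝ) ≤ 2)]]
    exact Real.sqrt_le_sqrt (by norm_num)
  have hps0 : 0 ≤ powScale s β ^ 3 := pow_nonneg (powScale_pos s β).le 3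
  calc Real.sqrt 2 * powScale 1 β ≤ 2 * powScale s β ^ 3 := mul_le_mul h2 h1 hp.le (by norm_num)
    _ ≤ 43 ^ 3 * powScale s β ^ 3 := mul_le_mul_of_nonneg_right (by norm_num) hps0
    _ = (43 * powScale s β) ^ 3 := by ring

/-- ★★ **THE POINTWISE RATIO BOUND OF RECORD**: for `L` with a non-zero site and `0 < s ≤ 1/3` there is `M₀` such that for every `M ≥ M₀`, eventually in `β`, for EVERY `U`,
`P₀(𝟙_Aχ)(U) ≤ 2^{d/2+2}·e^{−ℓ²/2}·P₀χ(U)`, `χ = recordChi L s 43 M β`, `A = {β^{-1}ℓ < ‖P_Γ relLinkVec‖}`, `ℓ = btLog β`, `d = flatDim L`. [cite: Luscher1983, §3] -/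
theorem eventually_basedAvg_indicator_far_le (hLz : Nonempty (NzSite L)) {s : ℝ} (hs : 0 < s) (hs3 : s ≤ 1 / 3) :
    ∃ M₀ : ℝ, 2 ≤ M₀ ∧ ∀ M : ℝ, M₀ ≤ M → ∀ᶠ β : ℝ in atTop, ∀ U : GaugeConfig 3 L SU2,
      ∫ h, {V : GaugeConfig 3 L SU2 | powScale 1 β * btLog β < ‖(gaugeModes L).starProjection (relLinkVec L V)‖}.indicator (recordChi L s 43 M β)
          (gaugeTransform (basedExt L h) U) ∂basedMeasure L ≤
        ((2 : ℝ) ^ (flatDim L / 2 + 2 : ℝ) * Real.exp (-(1 / 2 * btLog β ^ 2))) * ∫ h, recordChi L s 43 M β (gaugeTransform (basedExt L h) U) ∂basedMeasure L := by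
  have hδ0 : ∀ β, 0 < 43 * powScale s β := fun β => mul_pos (by norm_num) (powScale_pos s β)
  have hδ : Tendsto (fun β => 43 * powScale s β) atTop (𝓝 0) := by simpa using (tendsto_powScale hs).const_mul 43
  -- (P) at width `β^{-1}`
  have hsd1 : ∀ᶠ β in atTop, 0 < powScale 1 β ∧ powScale 1 β ≤ (43 * powScale s β) ^ 3 := by
    filter_upwards [eventually_sqrt_two_width_le hs3] with β h
    have h2 : 1 ≤ Real.sqrt 2 := by rw [← Real.sqrt_one]; exact Real.sqrt_le_sqrt (by norm_num)
    have hp := powScale_pos 1 β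
    exact ⟨hp, le_trans (by nlinarith) h.2⟩
  obtain ⟨M₁, hM₁, H₁⟩ := fpWeight_core_constant L hLz hδ0 hδ hsd1
  -- (P) at width `√2·β^{-1}`
  obtain ⟨M₂, hM₂, H₂⟩ := fpWeight_core_constant L hLz (δg := fun b => Real.sqrt 2 * powScale 1 b) hδ0 hδ (eventually_sqrt_two_width_le hs3)
  refine ⟨max M₁ M₂, le_max_of_le_left hM₁, fun M hM => ?_⟩
  obtain ⟨C₁, β₁, hC₁, hP₁⟩ := H₁ M (le_trans (le_max_left _ _) hM)
  obtain ⟨C₂, β₂, hC₂, hP₂⟩ := H₂ M (le_trans (le_max_right _ _) hM)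
  have hδ2 : Tendsto (fun β => (43 * powScale s β) ^ 2) atTop (𝓝 0) := by simpa using hδ.pow 2
  filter_upwards [eventually_ge_atTop β₁, eventually_ge_atTop β₂, eventually_mul_le_of_tendsto hδ2 C₁ (by norm_num : (0 : ℝ) < 1 / 2),
    eventually_mul_le_of_tendsto hδ2 C₂ one_pos] with β hβ1 hβ2 hCδ1 hCδ2 U
  set Nbar := fpWeightBar L (powScale 1 β) with hNbar
  have hNbar0 : 0 < Nbar := fpWeightBar_pos L (powScale_pos 1 β)
  have hNlo : 0 < Nbar * (1 - C₁ * (43 * powScale s β) ^ 2) := mul_pos hNbar0 (by linarith)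
  have hτ : 0 ≤ powScale 1 β * btLog β := mul_nonneg (powScale_pos 1 β).le (zero_le_one.trans (one_le_btLog β))
  have key := basedAvg_indicator_far_le_of_sandwich (fun β => 43 * powScale s β) (fun b => M * (43 * powScale s b)) (powScale 1)
    (τ := powScale 1 β * btLog β) (Nhi := fpWeightBar L (Real.sqrt 2 * powScale 1 β) * (1 + C₂ * (43 * powScale s β) ^ 2)) hτ (powScale_pos 1 β) hNlo
    (fun V hV => (hP₁ β hβ1 V hV).1) (fun V hV => (hP₂ β hβ2 V hV).2) U
  -- the constant: `e^{−ℓ²/2}·2^{d/2}N̄(1+C₂δ²)/(N̄(1−C₁δ²)) ≤ 2^{d/2+2}e^{−ℓ²/2}`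
  have hexp : Real.exp (-((powScale 1 β * btLog β) ^ 2 / (2 * powScale 1 β ^ 2))) = Real.exp (-(1 / 2 * btLog β ^ 2)) := by
    congr 1
    have hp : powScale 1 β ≠ 0 := (powScale_pos 1 β).ne'
    field_simp
  have hconst : Real.exp (-((powScale 1 β * btLog β) ^ 2 / (2 * powScale 1 β ^ 2))) * (fpWeightBar L (Real.sqrt 2 * powScale 1 β) * (1 + C₂ * (43 * powScale s β) ^ 2)) /
      (Nbar * (1 - C₁ * (43 * powScale s β) ^ 2)) ≤ (2 : ℝ) ^ (flatDim L / 2 + 2 : ℝ) * Real.exp (-(1 / 2 * btLog β ^ 2)) := by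
    rw [hexp, fpWeightBar_sqrt_two_mul, ← hNbar]
    have h2d : 0 < (2 : ℝ) ^ (flatDim L / 2 : ℝ) := Real.rpow_pos_of_pos (by norm_num) _
    have hsplit : (2 : ℝ) ^ (flatDim L / 2 + 2 : ℝ) = (2 : ℝ) ^ (flatDim L / 2 : ℝ) * 4 := by
      rw [Real.rpow_add (by norm_num : (0 : ℝ) < 2)]; norm_num
    rw [hsplit, div_le_iff₀ hNlo]
    have he0 : 0 < Real.exp (-(1 / 2 * btLog β ^ 2)) := Real.exp_pos _
    -- reduce to `(1 + C₂δ²) ≤ 4(1 − C₁δ²)`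
    have hineq : (1 + C₂ * (43 * powScale s β) ^ 2) ≤ 4 * (1 - C₁ * (43 * powScale s β) ^ 2) := by linarith
    have := mul_le_mul_of_nonneg_left hineq (le_of_lt (mul_pos (mul_pos he0 h2d) hNbar0))
    nlinarith [this]
  exact key.trans (mul_le_mul_of_nonneg_right hconst (integral_nonneg fun h => (recordChi_props (L := L) s 43 M β).2.2.1 _))

/-! ## §4 ★★★ The gauge-far tail of record in the currency of `hST` -/

/-- `sup K_β ≤ (e^{2β})^{|E|}` (`β ≥ 0`). [cite: SeilerLNP1982, §3] -/
theorem transferKernel_le_expCard {β : ℝ} (hβ : 0 ≤ β) (U V : GaugeConfig 3 L SU2) :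
    transferKernel su2Rep β U V ≤ Real.exp (2 * β) ^ Fintype.card (Edge 3 L) := by
  have h := transferKernel_le_expCard_mul_exp_action hβ U V
  have h1 : Real.exp (-(β / 2) * wilsonAction su2Rep U) ≤ 1 := Real.exp_le_one_iff.2 (by have := wilsonAction_su2_nonneg_lat U; nlinarith)
  have h2 : Real.exp (-(β / 2) * wilsonAction su2Rep V) ≤ 1 := Real.exp_le_one_iff.2 (by have := wilsonAction_su2_nonneg_lat V; nlinarith)
  have h12 : Real.exp (-(β / 2) * wilsonAction su2Rep U) * Real.exp (-(β / 2) * wilsonAction su2Rep V) ≤ 1 :=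
    mul_le_one₀ h1 (Real.exp_pos _).le h2
  exact h.trans (mul_le_of_le_one_right (by positivity) h12)

set_option maxHeartbeats 800000 in
-- long record expressions.
/-- ★★★ **THE GAUGE-FAR TAIL OF RECORD IN THE CURRENCY OF `hST`**: for `L` with a non-zero site and `0 < s ≤ 1/3` there is `M₀ ≥ 2` such that for every `M ≥ M₀` and
EVERY `a > 0`, eventually in `β`, every bounded measurable `f` supported in `{recordChi L s 43 M β ≠ 0}` has
`⟨P₀(𝟙_A f), K_β P₀(𝟙_A f)⟩ ≤ a·Λ(β)·tubeNormSq (softWeight (recordChi L s 43 M β)) f`, `A = {β^{-1}ℓ < ‖P_Γ relLinkVec‖}`,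
`Λ(β) = (btC/fpZ(btEps)/γ)·λ₀(L³β)`. [cite: Luscher1983, §3] [cite: SeilerLNP1982, §2] -/
theorem eventually_qform_basedAvg_far_record (hLz : Nonempty (NzSite L)) {s : ℝ} (hs : 0 < s) (hs3 : s ≤ 1 / 3) :
    ∃ M₀ : ℝ, 2 ≤ M₀ ∧ ∀ M : ℝ, M₀ ≤ M → ∀ a : ℝ, 0 < a → ∀ᶠ β : ℝ in atTop, ∀ f : GaugeConfig 3 L SU2 → ℝ, Measurable f → ∀ Cf : ℝ, (∀ U, |f U| ≤ Cf) →
      (∀ U, f U ≠ 0 → recordChi L s 43 M β U ≠ 0) →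
      qform su2Rep β
          (fun U => ∫ h, {V : GaugeConfig 3 L SU2 | powScale 1 β * btLog β < ‖(gaugeModes L).starProjection (relLinkVec L V)‖}.indicator f (gaugeTransform (basedExt L h) U)
            ∂basedMeasure L)
          (fun U => ∫ h, {V : GaugeConfig 3 L SU2 | powScale 1 β * btLog β < ‖(gaugeModes L).starProjection (relLinkVec L V)‖}.indicator f (gaugeTransform (basedExt L h) U)
            ∂basedMeasure L) ≤
        a * (btC L β (fun x : LinkSpace L => {x : LinkSpace L | linkCurry x ∈ capBalancedSet L}.indicator (fun _ => (1 : ℝ)) x * frozenProfile L (fun β' => stiffGaussExp L (β' / 2) β') (fun β' => min (1 / 40) (powScale (1 / 2) β' * btLog β')) β x) (btEps β) (5 * (powScale (1 / 2) β * btLog β ^ 2)) / fpZ (btEps β) / recordGamma L (fun β' => fun x : LinkSpace L => {x : LinkSpace L | linkCurry x ∈ capBalancedSet L}.indicator (fun _ => (1 : ℝ)) x * frozenProfile L (fun β'' => stiffGaussExp L (β'' / 2) β'') (fun β'' => min (1 / 40) (powScale (1 / 2) β'' * btLog β'')) β' x) β *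
          levelValue su2Rep 1 ((L : ℝ) ^ 3 * β) 0) * tubeNormSq (softWeight (recordChi L s 43 M β)) f := by
  obtain ⟨M₀, hM₀, H⟩ := eventually_basedAvg_indicator_far_le (L := L) hLz hs hs3
  refine ⟨M₀, hM₀, fun M hM a ha => ?_⟩
  have hP0 : (0 : ℝ) ≤ (2 : ℝ) ^ (flatDim L / 2 + 2 : ℝ) := (Real.rpow_pos_of_pos (by norm_num) _).le
  filter_upwards [H M hM, eventually_ge_atTop (0 : ℝ), eventually_tail_budget_le (L := L) (q := 1 / 2) (by norm_num) hP0 ha] with β hκ hβ hbud f hf Cf hCf hsupp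
  set A : Set (GaugeConfig 3 L SU2) := {V | powScale 1 β * btLog β < ‖(gaugeModes L).starProjection (relLinkVec L V)‖} with hAdef
  have hA : MeasurableSet A :=
    measurableSet_lt measurable_const ((gaugeModes L).starProjection.continuous.norm.measurable.comp (measurable_relLinkVec L))
  obtain ⟨hχm, hχ1, hχ0, hχc⟩ := recordChi_props (L := L) s 43 M β
  -- the `L²` bound of the based average of the far piece
  have hl2 := l2_basedAvg_indicator_le (L := L) hf hCf hχm hχ1 hχ0 (Real.exp_pos _) (fun U hU => (hχc U hU).1)
    (fun U hU => by by_contra hne; exact hsupp U hne hU) hA hκ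
  -- the crude kernel bound on `P₀(𝟙_A f)`
  have hCf0 : 0 ≤ Cf := (abs_nonneg _).trans (hCf 1)
  have hfA : Measurable (A.indicator f) := hf.indicator hA
  have hfAb : ∀ U, |A.indicator f U| ≤ Cf := fun U => by
    by_cases hU : U ∈ A
    · rw [Set.indicator_of_mem hU]; exact hCf U
    · rw [Set.indicator_of_notMem hU, abs_zero]; exact hCf0
  obtain ⟨hPm, hPb⟩ := basedIntegral_props (L := L) hfA hfAb
  have hq := qform_le_sup_mul_l2 β (fun U V => transferKernel_le_expCard (L := L) hβ U V) hPm hPb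
  have hl2eq : l2 (fun U => ∫ h, A.indicator f (gaugeTransform (basedExt L h) U) ∂basedMeasure L)
      (fun U => ∫ h, A.indicator f (gaugeTransform (basedExt L h) U) ∂basedMeasure L) =
      ∫ U, (∫ h, A.indicator f (gaugeTransform (basedExt L h) U) ∂basedMeasure L) ^ 2 ∂configMeasure SU2 L := by
    unfold l2; exact integral_congr_ae (ae_of_all _ fun U => by ring)
  rw [hl2eq] at hq
  have hw := integral_sq_mul_basedAvg_div_recordChi (L := L) s 43 M β f
  rw [hw] at hl2
  have hEK : 0 ≤ Real.exp (2 * β) ^ Fintype.card (Edge 3 L) := by positivity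
  have hT0 : 0 ≤ tubeNormSq (softWeight (recordChi L s 43 M β)) f :=
    integral_nonneg fun U => mul_nonneg (sq_nonneg _) ((softWeight_recordChi_props (L := L) s 43 M β).2.2.1 U)
  calc _ ≤ Real.exp (2 * β) ^ Fintype.card (Edge 3 L) * ∫ U, (∫ h, A.indicator f (gaugeTransform (basedExt L h) U) ∂basedMeasure L) ^ 2 ∂configMeasure SU2 L := hq
    _ ≤ Real.exp (2 * β) ^ Fintype.card (Edge 3 L) * (((2 : ℝ) ^ (flatDim L / 2 + 2 : ℝ) * Real.exp (-(1 / 2 * btLog β ^ 2))) *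
          tubeNormSq (softWeight (recordChi L s 43 M β)) f) := mul_le_mul_of_nonneg_left hl2 hEK
    _ = Real.exp (2 * β) ^ Fintype.card (Edge 3 L) * ((2 : ℝ) ^ (flatDim L / 2 + 2 : ℝ) * Real.exp (-(1 / 2 * btLog β ^ 2))) *
          tubeNormSq (softWeight (recordChi L s 43 M β)) f := by ring
    _ ≤ _ := mul_le_mul_of_nonneg_right hbud hT0

end Summit.QuantumFields.YangMills.Theorems.FemtoTransferGap.TwoLattice.ConstTube

end
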